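import Summits.CriticalPhenomena.CardyFormulaZ2.Theorems.CardyComplexConeEdgePrecompactUFRSDoublyMarkedLoop

/-!
# Arm domination, the START-PAIR final merge: certificates when a continuation past the deep corner returns
(line `qkz-strip-boundary-arm` of crux `CardyComplexCone.EdgePrecompact`, stmt-CriticalPhenomena-11387;
analysis of the shared planar residual of the registered residuals `ufrs_initialContactCase_certJ`
(its final-merge configuration, `…UFRSInitialBallLastSplit.lean`, `…UFRSInitialExitLoop.lean`) and
`ufrs_slippedReturnCase_certJ` (its START pair), see `…UFRSArmDominationResiduals.lean`)

Setting: an admissible datum `E` of the Jordan Dobrushin domain `D`, its translate `shiftData E w`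
(`‖E.δ w‖ < η`), the START pair `a`, `a'`, the good first stretch `S₀ = O₀ a [0, n]` of
`β₀ = E.bcBondConfig ω` entering the `2ρ`-deep ball `B(E.δ v, ρ)` at time `n`, and the run
`R₁ = O₁ a' [0, T]` of `β₁ = (shiftData E w).bcBondConfig ω` through inner faces of the translate,
avoiding the ball before `T` and ENDING ON the re-entry corner: `O₁ a' T = O₀ a n =: x₀` (the FINAL
MERGE of the two start strands, common tail into the ball). The planar analysis of this residual
(turning offset `∑_{t<n} turn₀ - ∑_{t<T} turn₁ ≠ 0`) compares the two orbits with the two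
CONTINUATIONS of the explorations past the deep corner `x₀` — `O₀ a (n, ·]` and `O₁ a' (T, ·]`, each
through the inner faces of its datum up to its exit — by closing them into trails of the oriented
medial graph; the mixed closed trails exist only when a continuation does NOT come back to the other
start strand. This file certifies the complementary events, with no hypothesis on turning numbers:

* `ufrs_finalMerge_return1_ST` (registered): if the translate's continuation `O₁ a' (T, u]` (inner faces
  of the translate) MEETS `S₀` at time `u`, or its vertex at time `u` is within `4η` of the start vertex
  `a.1`, then `ω ∈ ufrsCert E w z (4η) (ρ/2)` at a collar point `z ∈ D`: at the FIRST return
  `O₁ a' u' = O₀ a m'` (`T < u' ≤ u`) the predecessors differ (the continuation is off `S₀` before `u'`,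
  and `u' ≥ T + 2` since the corner after `x₀` starts in the ball), so either `m' = 0` (passage through
  `a`: NEAR at `E.δ a.1` from `S₀` and the continuation) or `cTgt (O₀ a (m' - 1))` is a merge edge at a
  collar corner (`ufrs_mergeCollar`) carrying the three pairwise corner-disjoint pieces `O₀ a [m', n]` (to
  the ball), `O₁ a' [T + 1, u' - 1]` (from the ball) and `O₀ a [0, m' - 2]` (back to the marked edge
  `cSrc a`): FAR or MARKED/NEAR (`mem_ufrsCert_of_three_far_W3H`, `mem_ufrsCert_of_two_far_and_marked_W3H`);
  with no return before `u`, NEAR at `E.δ a.1` from `S₀` and `O₁ a' [T + 1, u]`.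
* `ufrs_finalMerge_return0_ST` (registered): the symmetric statement for the continuation `O₀ a (n, u]`
  of the exploration of `E` meeting the run `R₁`, or coming within `4η` of the translate's start vertex
  `a'.1` (marked edge `cSrc a'` of `shiftData E w`; collar point `E.δ a.1`).

References: S. Smirnov, C. R. Acad. Sci. Paris 333 (2001), §2; G. Grimmett, *Percolation* (1999),
§11.2; P. Nolin, Electron. J. Probab. 13 (2008), §4 (arm events near marked boundary points).
-/

set_option linter.unusedVariables false

namespace Summit.CriticalPhenomena.CardyFormulaZ2.Cruxes.EdgePrecompact.QkzStripBoundaryArm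

open MeasureTheory Filter Set Metric
open scoped Topology BigOperators Pointwise
open Literature.Probability.LatticeModels Literature.Probability.Percolation
open Literature.Probability.RandomPlanarGeometry (DobrushinDomain)
open Summit.CriticalPhenomena.CardyFormulaZ2.Theses.CardyComplexCone

noncomputable section

/-! ## NEAR at a marked point -/

/-- **NEAR at a marked point from two long strands** (UFRS radii `r = 4η`, `R = ρ/2`, `E.δ ≤ η`): a
marked edge within `E.δ` of `z` and two corner-disjoint simple stretches through the corresponding
inner faces, each joining the `5η`-ball of `z` to distance `ρ/4`, give `ω ∈ ufrsCert E w z (4η) (ρ/2)`. -/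
theorem mem_ufrsCert_of_two_far_at_marked_ST {E : DiscreteDobrushin} {w : Site 2} {z : ℂ} {η ρ : ℝ} {ω : BondConfig (Site 2)}
    (τ₁ τ₂ : Bool) (c₁ c₂ : Site 2 × Fin 4) (i₁ j₁ i₂ j₂ : ℕ) (hη : 0 < η) (hδη : E.δ ≤ η)
    (hmarked : ∃ e₀ : Sym2 (Site 2), (e₀ ∈ E.zdABEdges ∨ e₀ ∈ (shiftData E w).zdABEdges) ∧ dist (medialPoint E.δ e₀) z ≤ E.δ)
    (h₁ : i₁ ≤ j₁ ∧ ((dist (meshPoint E.δ (cornerOrbit (if τ₁ then E.bcBondConfig ω else (shiftData E w).bcBondConfig ω) c₁ i₁).1) z ≤ (5 * η) ∧ (ρ / 2 / 2) ≤ dist (meshPoint E.δ (cornerOrbit (if τ₁ then E.bcBondConfig ω else (shiftData E w).bcBondConfig ω) c₁ j₁).1) z) ∨ ((ρ / 2 / 2) ≤ dist (meshPoint E.δ (cornerOrbit (if τ₁ then E.bcBondConfig ω else (shiftData E w).bcBondConfig ω) c₁ i₁).1) z ∧ dist (meshPoint E.δ (cornerOrbit (if τ₁ then E.bcBondConfig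 ω else (shiftData E w).bcBondConfig ω) c₁ j₁).1) z ≤ (5 * η))) ∧ (∀ t, i₁ ≤ t → t ≤ j₁ → if τ₁ then E.IsInnerFace (cFace (cornerOrbit (if τ₁ then E.bcBondConfig ω else (shiftData E w).bcBondConfig ω) c₁ t)) else (shiftData E w).IsInnerFace (cFace (cornerOrbit (if τ₁ then E.bcBondConfig ω else (shiftData E w).bcBondConfig ω) c₁ t))) ∧ (∀ s t, i₁ ≤ s → s < t → t ≤ j₁ → cornerOrbit (if τ₁ then E.bcBondConfig ω else (shiftData E w).bcBondConfig ω) c₁ s ≠ cornerOrbit (if τ₁ then E.bcBondConfig ω else (shiftData E w).bcBondConfig ω) c₁ t))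
    (h₂ : i₂ ≤ j₂ ∧ ((dist (meshPoint E.δ (cornerOrbit (if τ₂ then E.bcBondConfig ω else (shiftData E w).bcBondConfig ω) c₂ i₂).1) z ≤ (5 * η) ∧ (ρ / 2 / 2) ≤ dist (meshPoint E.δ (cornerOrbit (if τ₂ then E.bcBondConfig ω else (shiftData E w).bcBondConfig ω) c₂ j₂).1) z) ∨ ((ρ / 2 / 2) ≤ dist (meshPoint E.δ (cornerOrbit (if τ₂ then E.bcBondConfig ω else (shiftData E w).bcBondConfig ω) c₂ i₂).1) z ∧ dist (meshPoint E.δ (cornerOrbit (if τ₂ then E.bcBondConfig ω else (shiftData E w).bcBondConfig ω) c₂ j₂).1) z ≤ (5 * η))) ∧ (∀ t, i₂ ≤ t → t ≤ j₂ → if τ₂ then E.IsInnerFace (cFace (cornerOrbit (if τ₂ then E.bcBondConfig ω else (shiftData E w).bcBondConfig ω) c₂ t)) else (shiftData E w).IsInnerFace (cFace (cornerOrbit (if τ₂ then E.bcBondConfig ω else (shiftData E w).bcBondConfig ω) c₂ t))) ∧ (∀ s t, i₂ ≤ s → s < t → t ≤ j₂ → cornerOrbit (if τ₂ then E.bcBondConfig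 ω else (shiftData E w).bcBondConfig ω) c₂ s ≠ cornerOrbit (if τ₂ then E.bcBondConfig ω else (shiftData E w).bcBondConfig ω) c₂ t))
    (h₁₂ : ∀ s t, i₁ ≤ s → s ≤ j₁ → i₂ ≤ t → t ≤ j₂ → cornerOrbit (if τ₁ then E.bcBondConfig ω else (shiftData E w).bcBondConfig ω) c₁ s ≠ cornerOrbit (if τ₂ then E.bcBondConfig ω else (shiftData E w).bcBondConfig ω) c₂ t) :
    ω ∈ ufrsCert E w z (4 * η) (ρ / 2) := by
  apply mem_ufrsCert_of_near_W3H
  apply mem_ufrsCertNear_of_strands_W3H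
  · rw [mem_ufrsMarkedNbhd_iff]
    obtain ⟨e₀, he₀, hd⟩ := hmarked
    exact ⟨e₀, he₀, by linarith⟩
  · exact ufrsStrands_mono_W3H (by linarith) le_rfl (mem_ufrsStrands_two_W3H τ₁ τ₂ c₁ c₂ i₁ j₁ i₂ j₂ h₁ h₂ h₁₂)


/-! ## The translate's continuation returns to the first stretch or to the start vertex -/

/-- **START-PAIR final merge, the translate's continuation returns: the certificate** (registered helper
`ufrs_finalMerge_return1_ST` of stmt-CriticalPhenomena-11387). DATA: start corners `a` of `E` and `a'` of
`shiftData E w`, the good first stretch `O₀ a [0, n]` entering the `2ρ`-deep ball of radius `ρ ≥ 4η` at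
`n`, the run `O₁ a' [0, T]` of the translate's completion through its inner faces avoiding the ball
before `T` with `O₁ a' T = O₀ a n` (final merge), and a continuation `O₁ a' (T, u]` through inner faces
of the translate which at time `u` sits ON `S₀` or has its vertex within `4η` of `a.1`. CONCLUSION:
`ω ∈ ufrsCert E w z (4η) (ρ/2)` at a collar point `z ∈ D`. PROOF: see the module docstring (first
return `u'`; `u' ≥ T + 2`; passage through `a`, or a merge at the collar corner `O₀ a (m' - 1)` with the
three pieces `O₀ a [m', n]`, `O₁ a' [T + 1, u' - 1]`, `O₀ a [0, m' - 2]`; NEAR at `E.δ a.1` otherwise). -/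
theorem ufrs_finalMerge_return1_ST : ∀ (D : DobrushinDomain) (η : ℝ), 0 < η → ∃ δ₀ > (0:ℝ), ∀ E : DiscreteDobrushin, E.Ω = D.carrier → E.IsZdAdmissible → E.δ < δ₀ → ∀ (v w : Site 2) (ρ : ℝ), 4 * η ≤ ρ → 2 * ρ ≤ infDist (meshPoint E.δ v) D.carrierᶜ → ‖meshPoint E.δ w‖ < η → ∀ (ω : BondConfig (Site 2)) (a a' : Site 2 × Fin 4) (n T u : ℕ), E.IsStartCorner a → (shiftData E w).IsStartCorner a' → (∀ i < n, medialPoint E.δ (cTgt (cornerOrbit (E.bcBondConfig ω) a i)) ∉ ball (meshPoint E.δ v) ρ ∧ E.IsInnerFace (cFace (cornerOrbit (E.bcBondConfig ω) a (i + 1)))) → medialPoint E.δ (cTgt (cornerOrbit (E.bcBondConfig ω) a n)) ∈ ball (meshPoint E.δ v) ρ → (∀ i < T, medialPoint E.δ (cTgt (cornerOrbit ((shiftData E w).bcBondConfig ω) a' i)) ∉ ball (meshPoint E.δ v) ρ ∧ (shiftData E w).IsInnerFace (cFace (cornerOrbit ((shiftData E w).bcBondConfig ω) a' (i + 1)))) →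 cornerOrbit ((shiftData E w).bcBondConfig ω) a' T = cornerOrbit (E.bcBondConfig ω) a n → T < u → (∀ t, T < t → t ≤ u → (shiftData E w).IsInnerFace (cFace (cornerOrbit ((shiftData E w).bcBondConfig ω) a' t))) → ((∃ m ≤ n, cornerOrbit ((shiftData E w).bcBondConfig ω) a' u = cornerOrbit (E.bcBondConfig ω) a m) ∨ dist (meshPoint E.δ (cornerOrbit ((shiftData E w).bcBondConfig ω) a' u).1) (meshPoint E.δ a.1) ≤ 4 * η) → ∃ z ∈ D.carrier, infDist z D.carrierᶜ < 3 * η ∧ ω ∈ ufrsCert E w z (4 * η) (ρ / 2) := by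
  classical
  intro D η hη
  obtain ⟨δ₁, hδ₁, hmerge⟩ := ufrs_mergeCollar D η hη
  obtain ⟨δ₂, hδ₂, hcollar⟩ := collarAgreement D η hη
  refine ⟨min δ₁ (min δ₂ η), lt_min hδ₁ (lt_min hδ₂ hη), ?_⟩
  intro E hEΩ hE hEδ v w ρ hηρ hv hw ω a a' n T u ha ha' hStr hball hrun hmergeT hTu hcont hret
  have hδ : 0 < E.δ := hE.delta_pos
  have hδ₁' : E.δ < δ₁ := lt_of_lt_of_le hEδ (min_le_left _ _)
  have hδ₂' : E.δ < δ₂ := lt_of_lt_of_le hEδ ((min_le_right _ _).trans (min_le_left _ _))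
  have hδη : E.δ ≤ η := (lt_of_lt_of_le hEδ ((min_le_right _ _).trans (min_le_right _ _))).le
  have hE₁ : (shiftData E w).IsZdAdmissible := isZdAdmissible_shiftData E w hE
  set β₀ := E.bcBondConfig ω with hβ₀
  set β₁ := (shiftData E w).bcBondConfig ω with hβ₁
  -- faces and simplicity
  have hinner : ∀ x : Site 2, 3 * η ≤ infDist (meshPoint E.δ x) D.carrierᶜ → ∀ f : Site 2, IsCorner x f → E.IsInnerFace f ∧ (shiftData E w).IsInnerFace f :=
    fun x hx => (hcollar E hEΩ hE hδ₂' w hw ω x hx x (by rw [dist_self]; positivity)).2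
  have hfaceE : ∀ t ≤ n, E.IsInnerFace (cFace (cornerOrbit β₀ a t)) := by
    intro t ht
    rcases Nat.eq_zero_or_pos t with rfl | hpos
    · exact ha.isOutEdge.1
    · obtain ⟨t', rfl⟩ : ∃ t', t = t' + 1 := ⟨t - 1, by omega⟩
      exact (hStr t' (by omega)).2
  have hface₁ : ∀ t ≤ u, (shiftData E w).IsInnerFace (cFace (cornerOrbit β₁ a' t)) := by
    intro t ht
    rcases Nat.eq_zero_or_pos t with rfl | hpos
    · exact ha'.isOutEdge.1
    · rcases Nat.lt_or_ge T t with hTt | htT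
      · exact hcont t hTt ht
      · obtain ⟨t', rfl⟩ : ∃ t', t = t' + 1 := ⟨t - 1, by omega⟩
        exact (hrun t' (by omega)).2
  have hsimple : ∀ s t, s < t → t ≤ n → cornerOrbit β₀ a s ≠ cornerOrbit β₀ a t :=
    fun s t hst htn => cornerOrbit_ne hE ha hst (fun k hk => hfaceE k (by omega))
  have hsimple₁ : ∀ s t, s < t → t ≤ u → cornerOrbit β₁ a' s ≠ cornerOrbit β₁ a' t :=
    fun s t hst htu => cornerOrbit_ne hE₁ ha' hst (fun k hk => hface₁ k (by omega))
  have hzD : ∀ t ≤ n, meshPoint E.δ (cornerOrbit β₀ a t).1 ∈ D.carrier := by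
    intro t ht
    rw [← hEΩ]
    exact (ufrs_discrepancyEdges E w ω).2.2 _ (hfaceE t ht)
  have hcola : infDist (meshPoint E.δ a.1) D.carrierᶜ < 3 * η := by
    by_contra h
    rw [not_lt] at h
    exact ha.isOutEdge.2 (hinner a.1 h (faceAt a.1 (a.2 + 3)) (isCorner_faceAt _ _)).1
  have haD : meshPoint E.δ a.1 ∈ D.carrier := hzD 0 (Nat.zero_le _)
  -- escape regime
  by_cases hesc : ρ / 2 < 256 * (4 * η)
  · exact ⟨_, haD, hcola, mem_ufrsCert_of_lt_W3H hesc⟩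
  rw [not_lt] at hesc
  -- far ends: next to the ball
  have hfar : ∀ (c y : Site 2) (p : Site 2 × Fin 4), infDist (meshPoint E.δ c) D.carrierᶜ < 3 * η →
      medialPoint E.δ (cTgt p) ∈ ball (meshPoint E.δ v) ρ → dist (meshPoint E.δ y) (meshPoint E.δ p.1) ≤ E.δ →
      ρ / 2 / 2 ≤ dist (meshPoint E.δ y) (meshPoint E.δ c) := by
    intro c y p hc hp hy
    have := far_of_near_cTgt_mem_ball_W3H hδ.le hv hc (z := meshPoint E.δ c) (s := 0) (by rw [dist_self]) hp hy
    linarith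
  -- the corner after `x₀` starts in the ball
  have hT1src : cSrc (cornerOrbit β₁ a' (T + 1)) = cTgt (cornerOrbit β₀ a n) := by
    rw [cornerOrbit_succ, cSrc_nextCorner, hmergeT]
  have hT1near : dist (meshPoint E.δ (cornerOrbit β₁ a' (T + 1)).1) (meshPoint E.δ (cornerOrbit β₀ a n).1) ≤ E.δ := by
    have h := dist_meshPoint_cornerOrbit_succ_le β₁ a' E.δ T
    rw [abs_of_pos hδ, hmergeT] at h
    exact h
  -- the marked edge `cSrc a` at `E.δ a.1`
  have hmk : ∀ (c : ℂ) (X : ℝ), dist (meshPoint E.δ a.1) c ≤ X → ∃ e₀ : Sym2 (Site 2), (e₀ ∈ E.zdABEdges ∨ e₀ ∈ (shiftData E w).zdABEdges) ∧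
      dist (medialPoint E.δ e₀) c ≤ X + E.δ := by
    intro c X hX
    refine ⟨cSrc a, Or.inl (DiscreteDobrushin.cSrc_mem_zdABEdges ha.mem_zdArcA ha.mem_zdArcB (Or.inl ha.isOutEdge)), ?_⟩
    have h1 := dist_medialPoint_cSrc_le' hδ.le a
    have h2 := dist_triangle (medialPoint E.δ (cSrc a)) (meshPoint E.δ a.1) c
    linarith
  have hmk0 : ∃ e₀ : Sym2 (Site 2), (e₀ ∈ E.zdABEdges ∨ e₀ ∈ (shiftData E w).zdABEdges) ∧ dist (medialPoint E.δ e₀) (meshPoint E.δ a.1) ≤ E.δ := by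
    have h := hmk (meshPoint E.δ a.1) 0 (by rw [dist_self])
    rw [zero_add] at h
    exact h
  -- the whole first stretch is a long strand at `E.δ a.1`
  have hS0 : 0 ≤ n ∧ ((dist (meshPoint E.δ (cornerOrbit β₀ a 0).1) (meshPoint E.δ a.1) ≤ (5 * η) ∧ (ρ / 2 / 2) ≤ dist (meshPoint E.δ (cornerOrbit β₀ a n).1) (meshPoint E.δ a.1)) ∨ ((ρ / 2 / 2) ≤ dist (meshPoint E.δ (cornerOrbit β₀ a 0).1) (meshPoint E.δ a.1) ∧ dist (meshPoint E.δ (cornerOrbit β₀ a n).1) (meshPoint E.δ a.1) ≤ (5 * η))) ∧ (∀ t, 0 ≤ t → t ≤ n → E.IsInnerFace (cFace (cornerOrbit β₀ a t))) ∧ (∀ s t, 0 ≤ s → s < t → t ≤ n → cornerOrbit β₀ a s ≠ cornerOrbit β₀ a t) := by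
    refine ⟨Nat.zero_le _, Or.inl ⟨?_, hfar _ _ _ hcola hball (by rw [dist_self]; exact hδ.le)⟩, fun t _ ht => hfaceE t ht, fun s t _ hst ht => hsimple s t hst ht⟩
    show dist (meshPoint E.δ a.1) (meshPoint E.δ a.1) ≤ 5 * η
    rw [dist_self]; positivity
  -- FIRST return of the continuation to `S₀`, if any
  by_cases hP : ∃ u', T < u' ∧ u' ≤ u ∧ ∃ m ≤ n, cornerOrbit β₁ a' u' = cornerOrbit β₀ a m
  · obtain ⟨u₁, ⟨hTu₁, hu₁u, m', hm'n, hEq⟩, hmin⟩ : ∃ u₁, (T < u₁ ∧ u₁ ≤ u ∧ ∃ m ≤ n, cornerOrbit β₁ a' u₁ = cornerOrbit β₀ a m) ∧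
        ∀ u'', u'' < u₁ → ¬ (T < u'' ∧ u'' ≤ u ∧ ∃ m ≤ n, cornerOrbit β₁ a' u'' = cornerOrbit β₀ a m) :=
      ⟨Nat.find hP, Nat.find_spec hP, fun u'' h => Nat.find_min hP h⟩
    have hfree : ∀ u'', T < u'' → u'' < u₁ → ∀ m ≤ n, cornerOrbit β₁ a' u'' ≠ cornerOrbit β₀ a m :=
      fun u'' h1 h2 m hm h => hmin u'' h2 ⟨h1, by omega, m, hm, h⟩
    -- `m' < n`
    have hm' : m' < n := by
      rcases lt_or_eq_of_le hm'n with h | h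
      · exact h
      · exact absurd (hmergeT.trans (h ▸ hEq).symm) (hsimple₁ T u₁ hTu₁ hu₁u)
    -- `u₁ ≥ T + 2`: the corner after `x₀` starts in the ball
    have hu₁ : T + 2 ≤ u₁ := by
      by_contra h
      have hu₁eq : u₁ = T + 1 := by omega
      rw [hu₁eq] at hEq
      rcases Nat.eq_zero_or_pos m' with hm0 | hmpos
      · -- `O₁ a' (T+1) = a`: the marked edge would be in the ball
        rw [hm0] at hEq
        have hsrc : cSrc a = cTgt (cornerOrbit β₀ a n) := by rw [← hT1src, hEq]; rfl
        have hdeep := deep_of_cSrc_mem_ball (Ω := D.carrier) hδ.le hδη hηρ hv (a := a) (by rw [hsrc]; exact hball)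
        linarith
      · obtain ⟨m'', rfl⟩ : ∃ m'', m' = m'' + 1 := ⟨m' - 1, by omega⟩
        have hsrc : cTgt (cornerOrbit β₀ a m'') = cTgt (cornerOrbit β₀ a n) := by
          rw [← hT1src, hEq, cornerOrbit_succ, cSrc_nextCorner]
        exact (hStr m'' (by omega)).1 (by rw [hsrc]; exact hball)
    -- the predecessor of the return on the continuation
    set p₁ := cornerOrbit β₁ a' (u₁ - 1) with hp₁
    have hp₁succ : nextCorner β₁ p₁ = cornerOrbit β₁ a' u₁ := by
      rw [hp₁, ← cornerOrbit_succ, Nat.sub_add_cancel (by omega)]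
    have hS2far : ρ / 2 / 2 ≤ dist (meshPoint E.δ (cornerOrbit β₁ a' (T + 1)).1) (meshPoint E.δ a.1) :=
      hfar _ _ _ hcola hball hT1near
    rcases Nat.eq_zero_or_pos m' with hm0 | hmpos
    · -- passage through `a`: NEAR at the start vertex
      rw [hm0] at hEq
      have hp₁tgt : cTgt p₁ = cSrc a := by rw [← cSrc_nextCorner, hp₁succ, hEq]; rfl
      have hp₁near : dist (meshPoint E.δ p₁.1) (meshPoint E.δ a.1) ≤ 5 * η := by
        have h := dist_meshPoint_le_of_mem_cSrc_DM hδ.le (p := a) (y := p₁.1) (by rw [← hp₁tgt]; exact Sym2.mem_mk_left _ _)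
        linarith
      refine ⟨meshPoint E.δ a.1, haD, hcola, ?_⟩
      have hS2 : (T + 1) ≤ (u₁ - 1) ∧ ((dist (meshPoint E.δ (cornerOrbit β₁ a' (T + 1)).1) (meshPoint E.δ a.1) ≤ (5 * η) ∧ (ρ / 2 / 2) ≤ dist (meshPoint E.δ (cornerOrbit β₁ a' (u₁ - 1)).1) (meshPoint E.δ a.1)) ∨ ((ρ / 2 / 2) ≤ dist (meshPoint E.δ (cornerOrbit β₁ a' (T + 1)).1) (meshPoint E.δ a.1) ∧ dist (meshPoint E.δ (cornerOrbit β₁ a' (u₁ - 1)).1) (meshPoint E.δ a.1) ≤ (5 * η))) ∧ (∀ t, (T + 1) ≤ t → t ≤ (u₁ - 1) → (shiftData E w).IsInnerFace (cFace (cornerOrbit β₁ a' t))) ∧ (∀ s t, (T + 1) ≤ s → s < t → t ≤ (u₁ - 1) → cornerOrbit β₁ a' s ≠ cornerOrbit β₁ a' t) :=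
        ⟨by omega, Or.inr ⟨hS2far, hp₁near⟩, fun t _ ht => hface₁ t (by omega), fun s t _ hst ht => hsimple₁ s t hst (by omega)⟩
      have hS02 : ∀ s t, 0 ≤ s → s ≤ n → (T + 1) ≤ t → t ≤ (u₁ - 1) → cornerOrbit β₀ a s ≠ cornerOrbit β₁ a' t :=
        fun s t _ hsn ht1 ht h => hfree t (by omega) (by omega) s hsn h.symm
      exact mem_ufrsCert_of_two_far_at_marked_ST true false a a' 0 n (T + 1) (u₁ - 1) hη hδη hmk0 hS0 hS2 hS02
    · -- a merge at the collar corner `p₀ = O₀ a (m' - 1)`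
      set p₀ := cornerOrbit β₀ a (m' - 1) with hp₀
      have hp₀succ : nextCorner β₀ p₀ = cornerOrbit β₀ a m' := by
        rw [hp₀, ← cornerOrbit_succ, Nat.sub_add_cancel hmpos]
      have hne : p₀ ≠ p₁ := fun h => hfree (u₁ - 1) (by omega) (by omega) (m' - 1) (by omega) (by rw [← hp₁, ← h])
      have hnext : nextCorner β₀ p₀ = nextCorner β₁ p₁ := by rw [hp₀succ, hp₁succ, hEq]
      obtain ⟨hcol, htgt, -⟩ := hmerge E hEΩ hE hδ₁' w hw ω p₀ p₁ hne hnext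
      have hp₀D : meshPoint E.δ p₀.1 ∈ D.carrier := hzD (m' - 1) (by omega)
      refine ⟨meshPoint E.δ p₀.1, hp₀D, hcol, ?_⟩
      have hδ4 : E.δ ≤ 4 * η := by linarith
      -- strand 1: `O₀ a [m', n]`, from the merge to the ball
      have hS1near : dist (meshPoint E.δ (cornerOrbit β₀ a m').1) (meshPoint E.δ p₀.1) ≤ 4 * η := by
        have h := dist_meshPoint_cornerOrbit_succ_le β₀ p₀ E.δ 0
        rw [show cornerOrbit β₀ p₀ (0 + 1) = nextCorner β₀ p₀ from rfl, hp₀succ, abs_of_pos hδ] at h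
        exact le_trans h hδ4
      have hS1 : ∀ R' : ℝ, R' ≤ ρ / 2 / 2 → m' ≤ n ∧ ((dist (meshPoint E.δ (cornerOrbit β₀ a m').1) (meshPoint E.δ p₀.1) ≤ (4 * η) ∧ R' ≤ dist (meshPoint E.δ (cornerOrbit β₀ a n).1) (meshPoint E.δ p₀.1)) ∨ (R' ≤ dist (meshPoint E.δ (cornerOrbit β₀ a m').1) (meshPoint E.δ p₀.1) ∧ dist (meshPoint E.δ (cornerOrbit β₀ a n).1) (meshPoint E.δ p₀.1) ≤ (4 * η))) ∧ (∀ t, m' ≤ t → t ≤ n → E.IsInnerFace (cFace (cornerOrbit β₀ a t))) ∧ (∀ s t, m' ≤ s → s < t → t ≤ n → cornerOrbit β₀ a s ≠ cornerOrbit β₀ a t) :=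
        fun R' hR' => ⟨hm'n, Or.inl ⟨hS1near, hR'.trans (hfar _ _ _ hcol hball (by rw [dist_self]; exact hδ.le))⟩, fun t _ ht => hfaceE t ht, fun s t _ hst htn => hsimple s t hst htn⟩
      -- strand 2: `O₁ a' [T + 1, u₁ - 1]`, from the ball to the merge
      have hS2near : dist (meshPoint E.δ (cornerOrbit β₁ a' (u₁ - 1)).1) (meshPoint E.δ p₀.1) ≤ 4 * η := by
        have h := dist_meshPoint_le_of_mem_cTgt_DM hδ.le (p := p₀) (y := p₁.1) (by rw [htgt]; exact Sym2.mem_mk_left _ _)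
        exact h.trans hδ4
      have hS2 : ∀ R' : ℝ, R' ≤ ρ / 2 / 2 → (T + 1) ≤ (u₁ - 1) ∧ ((dist (meshPoint E.δ (cornerOrbit β₁ a' (T + 1)).1) (meshPoint E.δ p₀.1) ≤ (4 * η) ∧ R' ≤ dist (meshPoint E.δ (cornerOrbit β₁ a' (u₁ - 1)).1) (meshPoint E.δ p₀.1)) ∨ (R' ≤ dist (meshPoint E.δ (cornerOrbit β₁ a' (T + 1)).1) (meshPoint E.δ p₀.1) ∧ dist (meshPoint E.δ (cornerOrbit β₁ a' (u₁ - 1)).1) (meshPoint E.δ p₀.1) ≤ (4 * η))) ∧ (∀ t, (T + 1) ≤ t → t ≤ (u₁ - 1) → (shiftData E w).IsInnerFace (cFace (cornerOrbit β₁ a' t))) ∧ (∀ s t, (T + 1) ≤ s → s < t → t ≤ (u₁ - 1) → cornerOrbit β₁ a' s ≠ cornerOrbit β₁ a' t) :=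
        fun R' hR' => ⟨by omega, Or.inr ⟨hR'.trans (hfar _ _ _ hcol hball hT1near), hS2near⟩, fun t _ ht => hface₁ t (by omega), fun s t _ hst ht => hsimple₁ s t hst (by omega)⟩
      have hS12 : ∀ s t, m' ≤ s → s ≤ n → (T + 1) ≤ t → t ≤ (u₁ - 1) → cornerOrbit β₀ a s ≠ cornerOrbit β₁ a' t :=
        fun s t _ hsn ht1 ht h => hfree t (by omega) (by omega) s hsn h.symm
      rcases Nat.lt_or_ge m' 2 with hm1 | hm2
      · -- `m' = 1`: the merge is at the start corner, the marked edge is at `z`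
        have hm1' : m' = 1 := by omega
        have hp₀a : p₀ = a := by rw [hp₀, hm1']; rfl
        have hX0 : dist (meshPoint E.δ a.1) (meshPoint E.δ p₀.1) ≤ 0 := by rw [hp₀a, dist_self]
        have hXlt : (0:ℝ) < ρ / 2 / 2 := by linarith
        exact mem_ufrsCert_of_two_far_and_marked_W3H true false true a a' a m' n (T + 1) (u₁ - 1) 0 0 hη hδη hXlt (hmk _ 0 hX0) hS1 hS2 hS12
          (fun hbig => False.elim (by linarith))
      · -- strand 3: `O₀ a [0, m' - 2]`, read back to the start corner
        have hS3near : dist (meshPoint E.δ (cornerOrbit β₀ a (m' - 2)).1) (meshPoint E.δ p₀.1) ≤ 4 * η := by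
          have h := dist_meshPoint_cornerOrbit_succ_le β₀ a E.δ (m' - 2)
          rw [abs_of_pos hδ, show m' - 2 + 1 = m' - 1 by omega, dist_comm] at h
          linarith
        have hS3 : ∀ R' : ℝ, R' ≤ dist (meshPoint E.δ a.1) (meshPoint E.δ p₀.1) → 0 ≤ (m' - 2) ∧ ((dist (meshPoint E.δ (cornerOrbit β₀ a 0).1) (meshPoint E.δ p₀.1) ≤ (4 * η) ∧ R' ≤ dist (meshPoint E.δ (cornerOrbit β₀ a (m' - 2)).1) (meshPoint E.δ p₀.1)) ∨ (R' ≤ dist (meshPoint E.δ (cornerOrbit β₀ a 0).1) (meshPoint E.δ p₀.1) ∧ dist (meshPoint E.δ (cornerOrbit β₀ a (m' - 2)).1) (meshPoint E.δ p₀.1) ≤ (4 * η))) ∧ (∀ t, 0 ≤ t → t ≤ (m' - 2) → E.IsInnerFace (cFace (cornerOrbit β₀ a t))) ∧ (∀ s t, 0 ≤ s → s < t → t ≤ (m' - 2) → cornerOrbit β₀ a s ≠ cornerOrbit β₀ a t) :=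
          fun R' hR' => ⟨Nat.zero_le _, Or.inr ⟨hR', hS3near⟩, fun t _ ht => hfaceE t (by omega), fun s t _ hst ht => hsimple s t hst (by omega)⟩
        have hS13 : ∀ s t, m' ≤ s → s ≤ n → 0 ≤ t → t ≤ (m' - 2) → cornerOrbit β₀ a s ≠ cornerOrbit β₀ a t :=
          fun s t hs hsn _ ht h => hsimple t s (by omega) hsn h.symm
        have hS23 : ∀ s t, (T + 1) ≤ s → s ≤ (u₁ - 1) → 0 ≤ t → t ≤ (m' - 2) → cornerOrbit β₁ a' s ≠ cornerOrbit β₀ a t :=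
          fun s t hs hsu _ ht h => hfree s (by omega) (by omega) t (by omega) h
        by_cases hXfar : ρ / 2 / 2 ≤ dist (meshPoint E.δ a.1) (meshPoint E.δ p₀.1)
        · exact mem_ufrsCert_of_three_far_W3H true false true a a' a m' n (T + 1) (u₁ - 1) 0 (m' - 2) hη hesc (hS1 _ le_rfl) (hS2 _ le_rfl)
            (hS3 _ hXfar) hS12 hS13 hS23
        · rw [not_le] at hXfar
          exact mem_ufrsCert_of_two_far_and_marked_W3H true false true a a' a m' n (T + 1) (u₁ - 1) 0 (m' - 2) hη hδη hXfar (hmk _ _ le_rfl)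
            hS1 hS2 hS12 (fun _ => ⟨hS3 _ le_rfl, hS13, hS23⟩)
  · -- no return before `u`: the continuation reaches the `4η`-ball of the start vertex off `S₀`
    have hfree : ∀ u'', T < u'' → u'' ≤ u → ∀ m ≤ n, cornerOrbit β₁ a' u'' ≠ cornerOrbit β₀ a m :=
      fun u'' h1 h2 m hm h => hP ⟨u'', h1, h2, m, hm, h⟩
    have hnear : dist (meshPoint E.δ (cornerOrbit β₁ a' u).1) (meshPoint E.δ a.1) ≤ 4 * η := by
      rcases hret with ⟨m, hm, h⟩ | h
      · exact absurd h (hfree u hTu le_rfl m hm)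
      · exact h
    refine ⟨meshPoint E.δ a.1, haD, hcola, ?_⟩
    have hS2 : (T + 1) ≤ u ∧ ((dist (meshPoint E.δ (cornerOrbit β₁ a' (T + 1)).1) (meshPoint E.δ a.1) ≤ (5 * η) ∧ (ρ / 2 / 2) ≤ dist (meshPoint E.δ (cornerOrbit β₁ a' u).1) (meshPoint E.δ a.1)) ∨ ((ρ / 2 / 2) ≤ dist (meshPoint E.δ (cornerOrbit β₁ a' (T + 1)).1) (meshPoint E.δ a.1) ∧ dist (meshPoint E.δ (cornerOrbit β₁ a' u).1) (meshPoint E.δ a.1) ≤ (5 * η))) ∧ (∀ t, (T + 1) ≤ t → t ≤ u → (shiftData E w).IsInnerFace (cFace (cornerOrbit β₁ a' t))) ∧ (∀ s t, (T + 1) ≤ s → s < t → t ≤ u → cornerOrbit β₁ a' s ≠ cornerOrbit β₁ a' t) :=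
      ⟨hTu, Or.inr ⟨hfar _ _ _ hcola hball hT1near, by linarith⟩, fun t _ ht => hface₁ t ht, fun s t _ hst ht => hsimple₁ s t hst ht⟩
    have hS02 : ∀ s t, 0 ≤ s → s ≤ n → (T + 1) ≤ t → t ≤ u → cornerOrbit β₀ a s ≠ cornerOrbit β₁ a' t :=
      fun s t _ hsn ht1 ht h => hfree t (by omega) ht s hsn h.symm
    exact mem_ufrsCert_of_two_far_at_marked_ST true false a a' 0 n (T + 1) u hη hδη hmk0 hS0 hS2 hS02

end

end Summit.CriticalPhenomena.CardyFormulaZ2.Cruxes.EdgePrecompact.QkzStripBoundaryArm
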